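import Summits.QuantumFields.YangMills.Theses.ConvexGribovBody
import Summits.QuantumFields.YangMills.Theorems.ConvexGribovBodyNonSimplyConnectedLatticeGapStubSo3CompactConnectedGroup
import Summits.QuantumFields.YangMills.Theorems.ConvexGribovBodyNonSimplyConnectedLatticeGapStubSo3LatticeRep
import Summits.QuantumFields.YangMills.Theorems.ConvexGribovBodyNonSimplyConnectedLatticeGapStubNormalClauseMap
import Summits.QuantumFields.YangMills.Theorems.ConvexGribovBodyNonSimplyConnectedLatticeGapStubIsSimpleCompactGroupOfMulEquiv
import Summits.QuantumFields.YangMills.Theorems.ConvexGribovBodyNonSimplyConnectedLatticeGapStubSphereMulEquivSu2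
import Summits.QuantumFields.YangMills.Theorems.ConvexGribovBodyNonSimplyConnectedLatticeGapStubCenterSphereLeKerRotHom
import Literature.MathematicalPhysics.QuantumLattice.GaugeGroupsProofs
import HarnessLib

/-!
# Crux `NonSimplyConnectedLatticeGap` (stmt-QuantumFields-16405), route `ConvexGribovBody`, line `Sketch` —
# the first admissible instance: `SO(3)` is a non-simply-connected compact simple Lie group

The crux `Summit.QuantumFields.YangMills.Theses.ConvexGribovBody.NonSimplyConnectedLatticeGap`
(weak-coupling volume-uniform torus clustering) quantifies over compact topological groups `G`
with `IsCompactSimpleLieGroup G` (connected, non-abelian, every closed preconnected normal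
subgroup `⊥` or `⊤`, and a faithful continuous unitary matrix representation exists) and
`¬ SimplyConnectedSpace G`. Until now no such `G` was certified in the tree, so the crux, the
line's open stub `stub_cellAnalyticityNSC` and the disprover's `Negative/*` lemmas all spoke
about an uninstantiated class. This file composes the six landed side-stubs I1–I6 of skeleton
v3 (lead c2) into the certificate for `G = SO(3)`:

* `isSimpleCompactGroup_sphere` — the unit quaternions `S³` form a simple compact group:
  transported from the tree's PROVED `SU(2)` case
  (`Literature.MathematicalPhysics.QuantumLattice.isSimpleCompactGroup_specialUnitaryGroup_holds`)
  along the topological-group isomorphism `S³ ≃* SU(2)` given by `quatMatrix`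
  (I5 `stub_sphere_mulEquiv_su2`, I4 `stub_isSimpleCompactGroup_of_mulEquiv`);
* `so3_normalClause` — every closed preconnected normal subgroup of `SO(3)` is `⊥` or `⊤`:
  transfer along the covering homomorphism `rotHom : S³ →* SO3` (Hatcher §3.D; tree), a
  continuous surjection from a connected group whose kernel `{±1}` contains the centre
  (I3 `stub_normalClause_map`, I6 `stub_center_sphere_le_ker_rotHom`);
* `isSimpleCompactGroup_SO3`, `isCompactSimpleLieGroup_SO3` — with I1
  (`stub_so3_compactConnectedGroup`: topological group, compact, connected, non-abelian) and I2
  (`stub_so3_latticeRep`: the defining representation is faithful unitary);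
* `not_simplyConnectedSpace_SO3` — `π₁(SO(3), 1)` has two elements (tree
  `SO3.card_fundamentalGroup`);
* `exists_admissible_nonSimplyConnected` — **non-vacuity certificate**: the hypotheses of the
  crux are satisfiable (the `π₁ ≠ 0` twin of
  `BrascampLiebVacuumSC.Negative.exists_admissible_simplyConnected` for the sibling SC crux);
* `clustering_SO3_of_crux` — the crux has content: it yields weak-coupling clustering of `SO(3)`
  lattice gauge theory in every faithful unitary representation.

The instances `IsTopologicalGroup SO3`, `CompactSpace SO3`, `ConnectedSpace SO3` are the landed
theorems `so3_isTopologicalGroup`, `so3_compactSpace`, `so3_connectedSpace` (I1's file); they are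
supplied explicitly (`@`) or packed existentially, no instance is declared here. Nothing in this
file asserts a Theses statement; it supports the crux item.
-/

set_option autoImplicit false

noncomputable section

open Literature.MathematicalPhysics.QuantumFieldTheory Literature.MathematicalPhysics.QuantumLattice
open Literature.AlgebraicTopology.FundamentalGroup (SO3 rotHom continuous_rotHom surjective_rotHom)

namespace Summit.QuantumFields.YangMills.Theorems.NonSimplyConnectedLatticeGap

/-- **`S³` (the unit quaternions) is a simple compact group**: connected, non-abelian, and every
closed preconnected normal subgroup is `⊥` or `⊤` — transported from the tree's `SU(2)` theorem
along the topological-group isomorphism `quatMatrix : S³ ≃* SU(2)` (I4, I5). [folklore] -/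
theorem isSimpleCompactGroup_sphere : IsSimpleCompactGroup (Metric.sphere (0 : Quaternion ℝ) 1) := by
  obtain ⟨e, he, hes, -⟩ := stub_sphere_mulEquiv_su2
  have hSU : IsSimpleCompactGroup (Matrix.specialUnitaryGroup (Fin 2) ℂ) :=
    isSimpleCompactGroup_specialUnitaryGroup_holds (by simp)
  exact stub_isSimpleCompactGroup_of_mulEquiv _ _ e.symm hes (by simpa using he) hSU

/-- **Every closed preconnected normal subgroup of `SO(3)` is `⊥` or `⊤`**: transfer of the clause
from `S³` along the covering homomorphism `rotHom : S³ →* SO3` (continuous, surjective, kernel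
`{±1} ⊇` centre; I3, I6). [cite: HatcherAT2002, §3.D] -/
theorem so3_normalClause (N : Subgroup SO3) (hN : N.Normal) (hc : IsClosed (N : Set SO3))
    (hp : IsPreconnected (N : Set SO3)) : N = ⊥ ∨ N = ⊤ :=
  stub_normalClause_map (Metric.sphere (0 : Quaternion ℝ) 1) SO3 rotHom continuous_rotHom
    surjective_rotHom stub_center_sphere_le_ker_rotHom isSimpleCompactGroup_sphere.2.2 N hN hc hp

/-- **`SO(3)` is a simple compact group** in the tree's sense (connected, non-abelian, simplicity
clause). [folklore] -/
theorem isSimpleCompactGroup_SO3 : IsSimpleCompactGroup SO3 :=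
  ⟨so3_connectedSpace, so3_exists_mul_ne, fun N hN hc hp => so3_normalClause N hN hc hp⟩

/-- The defining representation makes `LatticeRep SO3` non-empty (I2). [folklore] -/
theorem nonempty_latticeRep_SO3 : Nonempty (LatticeRep SO3) := by
  obtain ⟨ρ, -, hρc, hρi, hρu⟩ := stub_so3_latticeRep
  exact ⟨⟨3, ρ, hρc, hρi, hρu⟩⟩

/-- **`SO(3)` is a compact simple Lie group** in the crux's sense
(`IsCompactSimpleLieGroup = IsSimpleCompactGroup ∧ Nonempty LatticeRep`; the `CompactSpace SO3`
instance argument is the landed theorem `so3_compactSpace`, supplied explicitly — any other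
instance gives the same proposition by proof irrelevance). [folklore] -/
theorem isCompactSimpleLieGroup_SO3 : @IsCompactSimpleLieGroup SO3 _ _ so3_compactSpace :=
  ⟨isSimpleCompactGroup_SO3, nonempty_latticeRep_SO3⟩

/-- **`SO(3)` is not simply connected**: a simply connected space has trivial fundamental group,
while `π₁(SO(3), 1)` has two elements (tree `SO3.card_fundamentalGroup`, from the universal cover
`S³ → SO(3)`). (Same argument as the disprover's workfile lemma of the same name.)
[cite: HatcherAT2002, §3.D] -/
theorem not_simplyConnectedSpace_SO3 : ¬ SimplyConnectedSpace SO3 := by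
  intro hsc
  haveI : Subsingleton (FundamentalGroup SO3 1) :=
    ⟨fun a b => (inferInstance : Subsingleton (Path.Homotopic.Quotient (1 : SO3) 1)).elim a b⟩
  have h1 : Nat.card (FundamentalGroup SO3 1) = 1 :=
    Nat.card_of_subsingleton (1 : FundamentalGroup SO3 1)
  have h2 := Literature.AlgebraicTopology.FundamentalGroup.SO3.card_fundamentalGroup
  omega

/-- **`SO(3)` is an admissible non-simply-connected gauge group**, packaged with its instances:
a compact simple Lie group in the crux's sense which is not simply connected. [folklore] -/
theorem so3_admissible :
    ∃ (_ : IsTopologicalGroup SO3) (_ : CompactSpace SO3),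
      IsCompactSimpleLieGroup SO3 ∧ ¬ SimplyConnectedSpace SO3 :=
  ⟨so3_isTopologicalGroup, so3_compactSpace, isCompactSimpleLieGroup_SO3, not_simplyConnectedSpace_SO3⟩

/-- **Non-vacuity certificate of the crux `NonSimplyConnectedLatticeGap`**: its hypotheses
(`IsCompactSimpleLieGroup G`, `¬ SimplyConnectedSpace G`, a lattice representation) are
satisfiable — by `G = SO(3)` with its Borel σ-algebra and defining representation — so neither the
crux nor the line's open stub `stub_cellAnalyticityNSC` is true for lack of instances. [folklore] -/
theorem exists_admissible_nonSimplyConnected :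
    ∃ (G : Type) (_ : Group G) (_ : TopologicalSpace G) (_ : IsTopologicalGroup G)
      (_ : CompactSpace G) (_ : MeasurableSpace G) (_ : BorelSpace G),
      IsCompactSimpleLieGroup G ∧ ¬ SimplyConnectedSpace G ∧ Nonempty (LatticeRep G) := by
  haveI : IsTopologicalGroup SO3 := so3_isTopologicalGroup
  haveI : CompactSpace SO3 := so3_compactSpace
  letI : MeasurableSpace SO3 := borel _
  haveI : BorelSpace SO3 := ⟨rfl⟩
  exact ⟨SO3, inferInstance, inferInstance, inferInstance, inferInstance, inferInstance,
    inferInstance, isCompactSimpleLieGroup_SO3, not_simplyConnectedSpace_SO3, nonempty_latticeRep_SO3⟩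

/-- **Registered stub `stub_admissibleInstanceNSC` of line `Sketch`** (non-vacuity of the crux's hypothesis class,
registered signature; closed by `exists_admissible_nonSimplyConnected`). [folklore] -/
theorem stub_admissibleInstanceNSC :
    ∃ (G : Type) (_ : Group G) (_ : TopologicalSpace G) (_ : IsTopologicalGroup G)
      (_ : CompactSpace G) (_ : MeasurableSpace G) (_ : BorelSpace G),
      Literature.MathematicalPhysics.QuantumFieldTheory.IsCompactSimpleLieGroup G ∧ ¬ SimplyConnectedSpace G ∧
        Nonempty (Literature.MathematicalPhysics.QuantumFieldTheory.LatticeRep G) :=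
  exists_admissible_nonSimplyConnected

/-- **The crux has content at `SO(3)`**: it yields the weak-coupling volume-uniform torus
clustering of `SO(3)` lattice gauge theory in every faithful unitary representation (Borel
σ-algebra). [folklore] -/
theorem clustering_SO3_of_crux
    (h : Summit.QuantumFields.YangMills.Theses.ConvexGribovBody.NonSimplyConnectedLatticeGap) :
    ∃ (_ : IsTopologicalGroup SO3) (_ : CompactSpace SO3) (_ : MeasurableSpace SO3) (_ : BorelSpace SO3),
      ∀ r : LatticeRep SO3, ∃ β₀ : ℝ, ∀ β : ℝ, β₀ ≤ β → ∃ m : ℝ, 0 < m ∧ ∃ S₁ : ℕ,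
      ∀ A B : YMSpecies SO3, ∃ C : ℝ, ∀ S n : ℕ, S₁ ≤ S → n ≤ S →
      |latticeConnectedCorr r.ρ β (2 * S + 1) A.F B.F n| ≤ C * Real.exp (-(m * n)) := by
  haveI : IsTopologicalGroup SO3 := so3_isTopologicalGroup
  haveI : CompactSpace SO3 := so3_compactSpace
  letI : MeasurableSpace SO3 := borel _
  haveI : BorelSpace SO3 := ⟨rfl⟩
  exact ⟨inferInstance, inferInstance, inferInstance, inferInstance,
    fun r => h SO3 isCompactSimpleLieGroup_SO3 not_simplyConnectedSpace_SO3 r⟩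

end Summit.QuantumFields.YangMills.Theorems.NonSimplyConnectedLatticeGap

end
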